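import Literature.NumberTheory.EllipticCurves.Rank1Residual.AnomalousDictionaryPrimesAboveProofs
import Literature.NumberTheory.EllipticCurves.BSDRankResidualCellsProofs
import HarnessLib

/-!
# Castella–Grossi–Lee–Skinner 2022, Theorem E: the `p`-converse to Gross–Zagier–Kolyvagin at a NON-ANOMALOUS Eisenstein prime `p > 2` of good reduction

HONEST FRAMING (cell `b2b-bsdres`, run/shared/lean/b2b/bsd-rank1-residual/; page 1 everywhere):
the goal of the cell is to DELETE the COMBINATION-SHAPED residual classes of the BSD formula for ALL
analytic-rank `≤ 1` curves over `ℚ` from PUBLISHED theorems only, so that the remainder becomes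
exactly the CONSTRUCTION-SHAPED classes, which are TYPED, not attempted; this is not "finishing
BSD". This file vendors ONE published theorem as a named fact (`def … : Prop`, nothing asserted;
D-0014/D-0026) — the reducible-residual-image (`E[p]` reducible, "Eisenstein") member of the tree's
family of `p`-CONVERSE theorems `corank_{ℤ_p} Sel_{p^∞}(E/ℚ) = 1 ⇒ ord_{s=1} L(E,s) = 1`
(bsd.S25 in `BSDSelmer.lean`: Skinner 2020 Thm. A′, Burungale–Skinner–Tian–Wan Thm. 1.10, C.-H. Kim
2022 for IRREDUCIBLE `E[p]`; Burungale–Tian for CM; Burungale–Kobayashi–Ota 2024 Thm. 1.5 for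
supersingular `p`), which until now had no Eisenstein entry ("The case of Eisenstein primes eluded
the methods of [Skinner, W. Zhang, JSW], which require `E[p]` to be absolutely irreducible",
`[corpus: paper:arxiv-2008.02571 p0004 L1–L3]`) — and PROVES its elementary reductions: the
printed `p`-converse to Gross–Zagier–Kolyvagin (`rank E(ℚ) = 1 ∧ #Ш(E/ℚ)[p^∞] < ∞ ⇒ r_an = 1`,
through the tree THEOREM `corank Sel_{p^∞} = rank + corank Ш[p^∞]`), the clause "and so
`rank E(ℚ) = 1` and `#Ш(E/ℚ) < ∞`" (Gross–Zagier–Kolyvagin, bsd.S17), the lane-decidable `a_p`-form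
of the hypothesis, and the hypothesis read LITERALLY at a decomposition group at `p` (tree
dictionary `Rank1Residual.not_anom_iff_cgs_of_mem_primesAbove`). Sibling files in this directory:
`EisensteinRankOnePPartBSD.lean` (Theorem F = Thm. 5.3.1, cell registry A52).

## Citation header (read by this seat on the store's LaTeXML text of the arXiv version, `paper:arxiv-2008.02571`)

* Authors: Francesc Castella, Giada Grossi, Jaehoon Lee, Christopher Skinner.
* Title: *On the anticyclotomic Iwasawa theory of rational elliptic curves at Eisenstein primes*.
* Venue: Invent. Math. **227** (2022), no. 2, 517–580, doi:10.1007/s00222-021-01072-y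
  = arXiv:2008.02571 (bib key `CastellaGrossiLeeSkinner2022`). REFEREED / PUBLISHED. The journal
  pagination of the individual theorems is not independently held (cite-only, as for Theorem F).
* Theorem: **Theorem E** of the Introduction (the fifth lettered intro item; LaTeXML renders the
  lettered items Conjecture A, Conjecture B, Theorem C, Corollary D, Theorem E, Theorem F as
  "Conjecture 1, Conjecture 2, Theorem 3, Corollary 4, Theorem 5, Theorem 6", so Theorem E =
  "Theorem 5" at `[corpus: paper:arxiv-2008.02571 p0004 L4–L13]`) = **Theorem 5.2.1** of the body
  (§5.2 "Proof of the `p`-converse", LaTeXML "Theorem 51", `[ibid. p0024 L99–L107]`: "The following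
  is Theorem (thm:E) in the introduction").
* Verbatim (Introduction, Theorem E):

> **Theorem E.** Let `E/ℚ` be an elliptic curve, and `p > 2` an Eisenstein prime for `E`, so that
> `E[p]^{ss} = 𝔽_p(φ) ⊕ 𝔽_p(ψ)` as `G_ℚ`-modules, and assume that `φ|_{G_p} ≠ 1, ω`. Then the
> following implication holds:
> `corank_{ℤ_p} Sel_{p^∞}(E/ℚ) = 1 ⟹ ord_{s=1} L(E,s) = 1`,
> and so `rank_ℤ E(ℚ) = 1` and `#Ш(E/ℚ) < ∞`.

  followed by (p0004 L15): "Note that if `rank_ℤ E(ℚ) = 1` and `#Ш(E/ℚ)[p^∞] < ∞` then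
  `corank_{ℤ_p} Sel_{p^∞}(E/ℚ) = 1`, whence the `p`-converse to (GZK)" [(GZK) =
  "`ord_{s=1} L(E,s) = 1 ⟹ rank_ℤ E(ℚ) = 1` and `#Ш(E/ℚ) < ∞`, of Gross–Zagier and Kolyvagin"].
  Body version (Thm. 5.2.1): "Assume that `E[p]^{ss} = 𝔽_p(φ) ⊕ 𝔽_p(ψ)` with `φ|_{G_p} ≠ 1, ω`.
  Then `corank_{ℤ_p} Sel_{p^∞}(E/ℚ) = 1 ⟹ ord_{s=1} L(E,s) = 1`, and so `rank_ℤ E(ℚ) = 1` and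
  `#Ш(E/ℚ) < ∞`." Definitions (§0.1, p0003 L7): "Let `E/ℚ` be an elliptic curve, and `p` a prime of
  good reduction for `E`. We say that `p` is an Eisenstein prime (for `E`) if the `G_ℚ`-module `E[p]`
  is reducible … Equivalently, `p` is an Eisenstein prime if `E` admits a rational `p`-isogeny";
  `ψ = ωφ⁻¹` with `ω` the Teichmüller character (p0003 L66); "`G_p ⊂ G_ℚ` a decomposition group at
  `p`". Printed proof (§5.2, p0024 L108 – p0025 L12): Monsky ⇒ `w(E/ℚ) = −1`; choose `K` imaginary
  quadratic with `D_K < −4` odd, every `ℓ ∣ N` split, `p` split, `L(E^K,1) ≠ 0` ([twist] =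
  Friedberg–Hoffstein / Bump–Friedberg–Hoffstein); Kolyvagin (or Kato) ⇒ `Sel_{p^∞}(E^K/ℚ)` finite ⇒
  `corank_{ℤ_p} Sel_{p^∞}(E/K) = 1` = (Sel); Corollary D (Perrin-Riou's Heegner point main
  conjecture, Cor. 4.2.3) ⇒ the bottom Heegner class `κ_1` is non-zero in `H¹(K, T_pE)` ⇒ `P_K`
  non-torsion ⇒ Gross–Zagier ⇒ `ord_{s=1} L(E/K,s) = 1` ⇒ `ord_{s=1} L(E,s) = 1`.

## Hypotheses, enumerated (word for word → cell predicate; same dictionary as the sibling Theorem F file and as `CastellaGrossiSkinner2025/EisensteinPPartBSD.lean`)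

1. "`E/ℚ` an elliptic curve" — `W : WeierstrassCurve ℚ`, `[W.IsElliptic]`, globally minimal model
   (`[W.IsGloballyMinimal]`, needed to read `a_p` off the model in `Anom`).
2. "`p > 2`" — `2 < p` (so `p = 3` is allowed, as printed; the documentation-only note
   `CGLS22-§3-6N@3` of the Theorem F file — the v1 corpus text's §3.2 standing "`p ∤ 6N`" versus the
   intro's `p > 2` — is RETIRED: the version of record (Invent. Math. 227 = arXiv v2, TeX ll. 935 /
   1253) reads "`p ∤ 2N`" there; referee C2 R358 (δ) confirmed the retirement and referee A R172.2
   admits `p = 3` flag-free; see that file's hypothesis 2. Not a hypothesis of the fact either way).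
3. "an Eisenstein prime for `E`" = (§0.1) a prime of GOOD reduction with `E[p]` REDUCIBLE —
   `Good W p ∧ Red W p` (`Red W p := ¬ E[p] irreducible`; `⟺ ∃ Φ, IsRationalLine W p Φ` by the tree
   theorems `exists_isRationalLine_of_not_irr` / `red_of_isRationalLine`). Ordinarity is then
   automatic (tree theorem `goodOrd_of_red_of_good`, Serre 1972; the paper: "By a result of
   Fontaine … Eisenstein primes are primes of ordinary reduction").
4. "`φ|_{G_p} ≠ 1, ω`" — `¬ Anom W p` (`a_p ≢ 1 (mod p)` given good ∧ reducible), EXACTLY as in the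
   two sibling facts; the dictionary is a tree THEOREM: for `p > 2` good, ANY rational line `Φ` and
   ANY prime `𝔓'` above `p`, `¬ Anom W p ⟺ (D_{𝔓'} does not fix Φ pointwise) ∧ (D_{𝔓'} does not act
   trivially on E[p]/Φ)` (`Rank1Residual.not_anom_iff_cgs_of_mem_primesAbove`), i.e.
   `φ|_{G_p} ≠ 1 ∧ ψ|_{G_p} ≠ 1` for the characters `φ`, `ψ = ωφ⁻¹` of `Φ` and `E[p]/Φ` — and the
   printed condition is symmetric in `{φ, ψ}`. The consumer
   `analyticRank_eq_one_of_thmE_of_cgs_of_mem_primesAbove` below takes the decomposition-group form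
   literally. Under this hypothesis `E(ℚ)[p] = 0` (paper, before Cor. 5.2.2: "the hypotheses of
   Theorem 5.2.1 include `E[p](ℚ) = 0`"; tree theorem `Rank1Residual.not_dvd_torsionOrder_of_not_anom`).
5. "`corank_{ℤ_p} Sel_{p^∞}(E/ℚ) = 1`" — `W.selmerCorank p = 1` (`WeierstrassCurve.selmerCorank`,
   `Selmer.lean`, the `ℤ_p`-corank of `selmerGroupPInfty W p`; the same atom as in every bsd.S25 fact).
6. Conclusion "`ord_{s=1} L(E,s) = 1`" — `W.analyticRank = 1`. The clause "and so `rank_ℤ E(ℚ) = 1`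
   and `#Ш(E/ℚ) < ∞`" is (GZK) applied to the conclusion; it is NOT folded into the fact but PROVED
   below from the tree's named (GZK) fact `rank_eq_analyticRank_of_analyticRank_le_one` (bsd.S17),
   exactly as the sibling files feed `Finite W.sha`.

No image condition, no (ram) prime, no conductor / semistability / CM / parity / Tamagawa condition.
No `_holds` is to be expected (Heegner-point Kolyvagin systems in the residually reducible setting,
Cor. D = Perrin-Riou's main conjecture, Gross–Zagier: none in Mathlib); consumers take
`(h : thmE_analyticRank_eq_one_of_selmerCorank_eq_one)`. NOT vendored here (documentation only):
Corollary 5.2.2 (the mod-`p` version "`dim_{𝔽_p} Sel_p(E/ℚ) = 1 ⟹ ord_{s=1} L(E,s) = 1`", whose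
printed reduction to Thm. 5.2.1 uses `E(ℚ)[p] = 0` and the Cassels–Tate pairing) and Corollary 5.2.3
(with [BKLS]: a positive proportion of quadratic twists of a curve with a rational `3`-isogeny have
algebraic and analytic rank `1`). FRESHNESS (2026-08-20): no published Eisenstein `p`-converse
supersedes Theorem E at good `p` (Castella–Grossi–Skinner, Math. Ann. 393 (2025) removes (Sel) from
Cor. D — its Thm. C — and proves the `p`-part of BSD, Thm. D, but states no `p`-converse; Keller–Yin
arXiv:2410.23241, a `p`-converse at potentially good ordinary Eisenstein primes of additive
reduction, is a PREPRINT). This file introduces exactly ONE named fact and proves its consumers;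
nothing else is minted.

## VERSION OF RECORD — the `r = 0` clause (appended, session 2 of the seat)

The corpus LaTeXML text `paper:arxiv-2008.02571` quoted above is arXiv **v1** (2020): its Theorem E /
Thm. 5.2.1 state the case `r = 1` only. The FINAL version — arXiv **v2**, 2021-09-14 (arXiv lists
v1 and v2 only; "v3" in the first filing of this paragraph was a slip for v2 — locator nit
`CGLS22-no-v3`, CITED-FACTS A152), arXiv comment
"Final version, to appear in Invent. Math" = the text of Invent. Math. 227 (2022) — read by this seat
on the TeX source fetched read-only from arxiv.org/e-print/2008.02571 (`Eisenstein.tex` L348–L366,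
Thm. E; L2519–L2558, Thm. 5.2.1 with its proof), states BOTH cases:

> **Theorem E (final version).** Let `E/ℚ` be an elliptic curve and `p > 2` an Eisenstein prime for
> `E`, so that `E[p]^{ss} = 𝔽_p(φ) ⊕ 𝔽_p(ψ)` as `G_ℚ`-modules, and assume that `φ|_{G_p} ≠ 1, ω`.
> Let `r ∈ {0,1}`. Then the following implication holds:
> `corank_{ℤ_p} Sel_{p^∞}(E/ℚ) = r ⟹ ord_{s=1} L(E,s) = r`, and so `rank_ℤ E(ℚ) = r` and
> `#Ш(E/ℚ) < ∞`.

followed by "Note that if `rank_ℤ E(ℚ) = r` and `#Ш(E/ℚ)[p^∞] < ∞` then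
`corank_{ℤ_p} Sel_{p^∞}(E/ℚ) = r`, whence the `p`-converse to (GZK)". Printed proof of the case
`r = 0` (Thm. 5.2.1, second half, L2548–L2557): Monsky ⇒ `w(E/ℚ) = +1`; choose `K` with (a)–(c) as
before and "(d') `ord_{s=1} L(E^K,1) = 1`" ([twist, Thm. B.2]); Gross–Zagier–Kolyvagin ⇒
`corank_{ℤ_p} Sel_{p^∞}(E^K/ℚ) = 1` ⇒ `corank_{ℤ_p} Sel_{p^∞}(E/K) = 1` = (Sel); Cor. 4.2.4
(`cor:PR`) + Gross–Zagier ⇒ `ord_{s=1} L(E/K,s) = 1` ⇒ `L(E,1) ≠ 0`. The `r = 1` fact above is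
unchanged (it is the `r = 1` clause of both versions); the `r = 0` clause is vendored below as the
second named fact of this file, `thmE_analyticRank_eq_zero_of_selmerCorank_eq_zero`, with the same
transcription, and the two are combined in `analyticRank_eq_of_thmE_of_selmerCorank_eq`. (Corpus
note for the cell lead: the store's text of this paper is v1; Thm. F = A52 reads the same in v2;
Thm. 5.1.1's displayed hypothesis list in v2 is "`E(ℚ_p)[p] = 0`, `rank_ℤ E(K) = 1`,
`#Ш(E/K)[p^∞] < ∞`".)

## References
* [CastellaGrossiLeeSkinner2022] F. Castella, G. Grossi, J. Lee, C. Skinner, *On the anticyclotomic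
  Iwasawa theory of rational elliptic curves at Eisenstein primes*, Invent. Math. 227 (2022) 517–580
  = arXiv:2008.02571: Theorem E = Thm. 5.2.1; Cor. 5.2.2, Cor. 5.2.3; Cor. D = Cor. 4.2.3; §0.1.
* R. Greenberg, *Iwasawa theory for elliptic curves*, LNM 1716 (1999) §1 (corank identity; tree
  theorem `WeierstrassCurve.selmerCorank_eq_mordellWeilRank_add_holds`). [Greenberg1999]
* B. Gross, D. Zagier (1986); V. Kolyvagin (1990) — (GZK), tree fact
  `rank_eq_analyticRank_of_analyticRank_le_one` (bsd.S17).
* bsdN/HYPOTHESES.md row T-CGS (`anom`); RESIDUAL-CASES.md §a.0, §a.1 C6, §a.2 X1; cell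
  HOME/CITED-FACTS.md (this theorem: new row, seat `b2b-bsdres-lit-cgls`).
-/

noncomputable section

open scoped Classical NumberField

open WeierstrassCurve Literature.NumberTheory.EllipticCurves Literature.NumberTheory.GaloisRepresentations
  Field IsDedekindDomain NumberField Rat.HeightOneSpectrum
  Literature.NumberTheory.EllipticCurves.Rank1Residual

namespace Literature.NumberTheory.EllipticCurves.CastellaGrossiLeeSkinner2022

/-- **Castella–Grossi–Lee–Skinner, Invent. Math. 227 (2022) 517–580 = arXiv:2008.02571, Theorem E
(Introduction; LaTeXML "Theorem 5") = Theorem 5.2.1 (§5.2; LaTeXML "Theorem 51")**: "Let `E/ℚ` be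
an elliptic curve, and `p > 2` an Eisenstein prime for `E` [§0.1: a prime of good reduction for `E`
with `E[p]` reducible, equivalently `E` admits a rational `p`-isogeny], so that
`E[p]^{ss} = 𝔽_p(φ) ⊕ 𝔽_p(ψ)` as `G_ℚ`-modules, and assume that `φ|_{G_p} ≠ 1, ω`. Then the
following implication holds: `corank_{ℤ_p} Sel_{p^∞}(E/ℚ) = 1 ⟹ ord_{s=1} L(E,s) = 1`, and so
`rank_ℤ E(ℚ) = 1` and `#Ш(E/ℚ) < ∞`." Hypotheses in the cell's predicate names (module docstring,
items 1–6): `2 < p`, `Good W p`, `Red W p`, `¬ Anom W p` (= "`φ|_{G_p} ≠ 1, ω`", tree theorem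
`not_anom_iff_cgs_of_mem_primesAbove`), `W.selmerCorank p = 1`; conclusion `W.analyticRank = 1`
(the "and so" clause is (GZK), proved separately below). No image, (ram), conductor, CM, parity or
Tamagawa hypothesis. PUBLISHED; the Eisenstein member of the bsd.S25 family of `p`-converse
theorems. [cite: CastellaGrossiLeeSkinner2022, Theorem E = Thm. 5.2.1 (arXiv:2008.02571 §5.2; Introduction Thm. E; §0.1 for "Eisenstein prime")] -/
def thmE_analyticRank_eq_one_of_selmerCorank_eq_one : Prop :=
  ∀ (W : WeierstrassCurve ℚ) [W.IsElliptic] [W.IsGloballyMinimal] (p : ℕ) [Fact p.Prime],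
    2 < p → Good W p → Red W p → ¬ Anom W p → W.selmerCorank p = 1 → W.analyticRank = 1

variable {W : WeierstrassCurve ℚ} {p : ℕ} [Fact p.Prime]

/-- **Theorem E, full printed conclusion**: under its hypotheses, `corank_{ℤ_p} Sel_{p^∞}(E/ℚ) = 1`
gives `ord_{s=1} L(E,s) = 1` (the fact) "and so `rank_ℤ E(ℚ) = 1` and `#Ш(E/ℚ) < ∞`" — the latter by
Gross–Zagier–Kolyvagin (`hGZK`, the tree's named fact bsd.S17, fed exactly as in the sibling files).
[cite: CastellaGrossiLeeSkinner2022, Theorem E = Thm. 5.2.1 ("and so" clause)] -/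
theorem rank_eq_one_and_finite_sha_of_thmE [W.IsElliptic] [W.IsGloballyMinimal]
    (h : thmE_analyticRank_eq_one_of_selmerCorank_eq_one)
    (hGZK : rank_eq_analyticRank_of_analyticRank_le_one)
    (hp : 2 < p) (hgood : Good W p) (hred : Red W p) (hna : ¬ Anom W p)
    (hcork : W.selmerCorank p = 1) :
    W.analyticRank = 1 ∧ W.mordellWeilRank = 1 ∧ Finite W.sha := by
  have hr : W.analyticRank = 1 := h W p hp hgood hred hna hcork
  obtain ⟨hrk, hfin⟩ := hGZK W hr.le
  exact ⟨hr, hrk.trans hr, hfin⟩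

/-- **The `p`-converse to Gross–Zagier–Kolyvagin at a non-anomalous Eisenstein prime** (the remark
printed after Theorem E: "if `rank_ℤ E(ℚ) = 1` and `#Ш(E/ℚ)[p^∞] < ∞` then
`corank_{ℤ_p} Sel_{p^∞}(E/ℚ) = 1`, whence the `p`-converse to (GZK)"): `p > 2` good with `E[p]`
reducible and `a_p ≢ 1 (mod p)`, `rank_ℤ E(ℚ) = 1`, `Ш(E/ℚ)[p^∞]` finite ⇒ `ord_{s=1} L(E,s) = 1`.
The reduction is the tree THEOREM `corank Sel_{p^∞}(E/ℚ) = rank E(ℚ) + corank Ш(E/ℚ)[p^∞]`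
(Greenberg 1999 §1; `selmerCorank_eq_mordellWeilRank_of_finite_shaPrimary`).
[cite: CastellaGrossiLeeSkinner2022, Theorem E and the remark following it (arXiv:2008.02571 p. 4)] -/
theorem analyticRank_eq_one_of_thmE_of_mordellWeilRank_eq_one [W.IsElliptic] [W.IsGloballyMinimal]
    (h : thmE_analyticRank_eq_one_of_selmerCorank_eq_one)
    (hp : 2 < p) (hgood : Good W p) (hred : Red W p) (hna : ¬ Anom W p)
    (hrank : W.mordellWeilRank = 1) (hsha : Finite (AddCommGroup.primaryComponent W.sha p)) :
    W.analyticRank = 1 :=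
  h W p hp hgood hred hna
    ((selmerCorank_eq_mordellWeilRank_of_finite_shaPrimary W p hsha).trans hrank)

/-- The same `p`-converse with the full Tate–Shafarevich group finite (`Finite W.sha`, the binder
the cell's class files carry) instead of its `p`-primary part. [cite: CastellaGrossiLeeSkinner2022, Theorem E and the remark following it] -/
theorem analyticRank_eq_one_of_thmE_of_mordellWeilRank_eq_one_of_finite_sha [W.IsElliptic]
    [W.IsGloballyMinimal] (h : thmE_analyticRank_eq_one_of_selmerCorank_eq_one)
    (hp : 2 < p) (hgood : Good W p) (hred : Red W p) (hna : ¬ Anom W p)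
    (hrank : W.mordellWeilRank = 1) (hsha : Finite W.sha) : W.analyticRank = 1 :=
  analyticRank_eq_one_of_thmE_of_mordellWeilRank_eq_one h hp hgood hred hna hrank inferInstance

/-- **Rank one is analytic rank one at a non-anomalous Eisenstein prime**: under Theorem E's
hypotheses on `(E, p)` and `#Ш(E/ℚ)[p^∞] < ∞`, `rank_ℤ E(ℚ) = 1 ↔ ord_{s=1} L(E,s) = 1` — Theorem E
one way, Gross–Zagier–Kolyvagin (`hGZK`) the other. [cite: CastellaGrossiLeeSkinner2022, Theorem E with (GZK)] -/
theorem mordellWeilRank_eq_one_iff_analyticRank_eq_one_of_thmE [W.IsElliptic] [W.IsGloballyMinimal]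
    (h : thmE_analyticRank_eq_one_of_selmerCorank_eq_one)
    (hGZK : rank_eq_analyticRank_of_analyticRank_le_one)
    (hp : 2 < p) (hgood : Good W p) (hred : Red W p) (hna : ¬ Anom W p)
    (hsha : Finite (AddCommGroup.primaryComponent W.sha p)) :
    W.mordellWeilRank = 1 ↔ W.analyticRank = 1 := by
  refine ⟨fun hrank ↦ analyticRank_eq_one_of_thmE_of_mordellWeilRank_eq_one h hp hgood hred hna
    hrank hsha, fun hr ↦ ?_⟩
  exact (hGZK W hr.le).1.trans hr

/-- **Theorem E in `a_p`-form**: `p > 2` good, `E[p]` reducible, `a_p ≢ 1 (mod p)`,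
`corank_{ℤ_p} Sel_{p^∞}(E/ℚ) = 1` ⇒ `ord_{s=1} L(E,s) = 1` (the lane-decidable form of "`φ|_{G_p} ≠ 1, ω`" at
a good Eisenstein prime is `a_p ≢ 1 (mod p)`: tree lemma
`CastellaGrossiSkinner2025.not_anom_iff_of_red_of_good`, an unfolding of `Rank1Residual.Anom`).
[cite: CastellaGrossiLeeSkinner2022, Theorem E = Thm. 5.2.1] -/
theorem analyticRank_eq_one_of_thmE_of_not_dvd [W.IsElliptic] [W.IsGloballyMinimal]
    (h : thmE_analyticRank_eq_one_of_selmerCorank_eq_one)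
    (hp : 2 < p) (hgood : Good W p) (hred : Red W p) (hap : ¬ (p : ℤ) ∣ W.frobeniusTrace p - 1)
    (hcork : W.selmerCorank p = 1) : W.analyticRank = 1 :=
  h W p hp hgood hred ((CastellaGrossiSkinner2025.not_anom_iff_of_red_of_good hred hgood).2 hap) hcork

/-- **Theorem E with its printed hypothesis at any decomposition group at `p`**: `W/ℚ` globally
minimal elliptic, a good prime `p > 2`, the kernel `Φ` of a rational `p`-isogeny (so `E[p]` is
reducible and `E[p]^{ss} = 𝔽_p(φ) ⊕ 𝔽_p(ψ)` with `φ` the character of `Φ`, `ψ = ωφ⁻¹` that of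
`E[p]/Φ`), a prime `𝔓'` of `ℤ̄` above `p` whose decomposition group `D_{𝔓'} = G_p` neither fixes `Φ`
pointwise (`φ|_{G_p} ≠ 1`) nor acts trivially on `E[p]/Φ` (`ψ|_{G_p} ≠ 1`, i.e. `φ|_{G_p} ≠ ω`), and
`corank_{ℤ_p} Sel_{p^∞}(E/ℚ) = 1` ⇒ `ord_{s=1} L(E,s) = 1` — from the named fact through the tree
dictionary `not_anom_iff_cgs_of_mem_primesAbove` and `red_of_isRationalLine`.
[cite: CastellaGrossiLeeSkinner2022, Theorem E = Thm. 5.2.1 (hypothesis on φ read at a decomposition group at p)] -/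
theorem analyticRank_eq_one_of_thmE_of_cgs_of_mem_primesAbove [W.IsElliptic] [W.IsGloballyMinimal]
    (h : thmE_analyticRank_eq_one_of_selmerCorank_eq_one)
    (hp : 2 < p) (hgood : Good W p)
    {v : HeightOneSpectrum (𝓞 ℚ)} (hv : (primesEquiv v : ℕ) = p)
    {𝔓' : Ideal (absIntegers (𝓞 ℚ) ℚ)} (h𝔓' : 𝔓' ∈ v.primesAbove)
    {Φ : AddSubgroup (geomTorsion W (p : ℤ))} (hΦ : IsRationalLine W p Φ)
    (hφ1 : ¬ ∀ g ∈ 𝔓'.decompositionSubgroup (absoluteGaloisGroup ℚ), ∀ P ∈ Φ, g • P = P)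
    (hφω : ¬ ∀ g ∈ 𝔓'.decompositionSubgroup (absoluteGaloisGroup ℚ), ∀ P : geomTorsion W (p : ℤ),
      g • P - P ∈ Φ)
    (hcork : W.selmerCorank p = 1) : W.analyticRank = 1 :=
  h W p hp hgood (red_of_isRationalLine hΦ)
    ((not_anom_iff_cgs_of_mem_primesAbove hp hgood hv h𝔓' hΦ).2 ⟨hφ1, hφω⟩) hcork

/-! ### Appended (session 2): Theorem E, case `r = 0`, from the version of record -/

/-- **Castella–Grossi–Lee–Skinner, Invent. Math. 227 (2022) 517–580 = arXiv:2008.02571v2 ("Final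
version"), Theorem E = Theorem 5.2.1, case `r = 0`**: "Let `E/ℚ` be an elliptic curve and `p > 2` an
Eisenstein prime for `E` [§0.1: a prime of good reduction with `E[p]` reducible, equivalently `E`
admits a rational `p`-isogeny], so that `E[p]^{ss} = 𝔽_p(φ) ⊕ 𝔽_p(ψ)` as `G_ℚ`-modules, and assume
that `φ|_{G_p} ≠ 1, ω`. Let `r ∈ {0,1}`. Then the following implication holds:
`corank_{ℤ_p} Sel_{p^∞}(E/ℚ) = r ⟹ ord_{s=1} L(E,s) = r`, and so `rank_ℤ E(ℚ) = r` and
`#Ш(E/ℚ) < ∞`" — here `r = 0` (the clause `r = 1` is `thmE_analyticRank_eq_one_of_selmerCorank_eq_one`,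
typed from arXiv v1, which states that clause alone). Same transcription: `2 < p`, `Good W p`,
`Red W p`, `¬ Anom W p` (= "`φ|_{G_p} ≠ 1, ω`"), `W.selmerCorank p = 0`; conclusion
`W.analyticRank = 0` (i.e. `L(E,1) ≠ 0`; the "and so" clause is (GZK)/Kolyvagin, proved below). No
image, (ram), conductor, CM, parity or Tamagawa hypothesis. PUBLISHED.
[cite: CastellaGrossiLeeSkinner2022, Theorem E = Thm. 5.2.1, case r = 0 (final version arXiv:2008.02571v2 = Invent. Math. 227 (2022); proof §5.2, second half)] -/
def thmE_analyticRank_eq_zero_of_selmerCorank_eq_zero : Prop :=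
  ∀ (W : WeierstrassCurve ℚ) [W.IsElliptic] [W.IsGloballyMinimal] (p : ℕ) [Fact p.Prime],
    2 < p → Good W p → Red W p → ¬ Anom W p → W.selmerCorank p = 0 → W.analyticRank = 0

/-- **Theorem E as printed in the final version, both cases**: under its hypotheses on `(E, p)`,
`corank_{ℤ_p} Sel_{p^∞}(E/ℚ) = r` with `r ∈ {0,1}` gives `ord_{s=1} L(E,s) = r` — the two vendored
clauses side by side. [cite: CastellaGrossiLeeSkinner2022, Theorem E = Thm. 5.2.1 (r ∈ {0,1})] -/
theorem analyticRank_eq_of_thmE_of_selmerCorank_eq [W.IsElliptic] [W.IsGloballyMinimal]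
    (h1 : thmE_analyticRank_eq_one_of_selmerCorank_eq_one)
    (h0 : thmE_analyticRank_eq_zero_of_selmerCorank_eq_zero)
    (hp : 2 < p) (hgood : Good W p) (hred : Red W p) (hna : ¬ Anom W p)
    {r : ℕ} (hr : r = 0 ∨ r = 1) (hcork : W.selmerCorank p = r) : W.analyticRank = r := by
  rcases hr with rfl | rfl
  · exact h0 W p hp hgood hred hna hcork
  · exact h1 W p hp hgood hred hna hcork

/-- **Case `r = 0`, full printed conclusion**: `corank_{ℤ_p} Sel_{p^∞}(E/ℚ) = 0` gives
`ord_{s=1} L(E,s) = 0` (the fact) "and so `rank_ℤ E(ℚ) = 0` and `#Ш(E/ℚ) < ∞`" — by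
Gross–Zagier–Kolyvagin (`hGZK`, bsd.S17; in print "Kolyvagin (or Kato)").
[cite: CastellaGrossiLeeSkinner2022, Theorem E = Thm. 5.2.1, case r = 0 ("and so" clause)] -/
theorem rank_eq_zero_and_finite_sha_of_thmE [W.IsElliptic] [W.IsGloballyMinimal]
    (h0 : thmE_analyticRank_eq_zero_of_selmerCorank_eq_zero)
    (hGZK : rank_eq_analyticRank_of_analyticRank_le_one)
    (hp : 2 < p) (hgood : Good W p) (hred : Red W p) (hna : ¬ Anom W p)
    (hcork : W.selmerCorank p = 0) :
    W.analyticRank = 0 ∧ W.mordellWeilRank = 0 ∧ Finite W.sha := by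
  have hr : W.analyticRank = 0 := h0 W p hp hgood hred hna hcork
  obtain ⟨hrk, hfin⟩ := hGZK W (by omega)
  exact ⟨hr, hrk.trans hr, hfin⟩

/-- **The rank-`0` `p`-converse at a non-anomalous Eisenstein prime** (the remark after Theorem E,
final version: "if `rank_ℤ E(ℚ) = r` and `#Ш(E/ℚ)[p^∞] < ∞` then `corank_{ℤ_p} Sel_{p^∞}(E/ℚ) = r`,
whence the `p`-converse to (GZK)", at `r = 0`): `p > 2` good with `E[p]` reducible and
`a_p ≢ 1 (mod p)`, `rank_ℤ E(ℚ) = 0`, `Ш(E/ℚ)[p^∞]` finite ⇒ `ord_{s=1} L(E,s) = 0`, through the tree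
THEOREM `corank Sel_{p^∞}(E/ℚ) = rank E(ℚ) + corank Ш(E/ℚ)[p^∞]`.
[cite: CastellaGrossiLeeSkinner2022, Theorem E (final version) and the remark following it] -/
theorem analyticRank_eq_zero_of_thmE_of_mordellWeilRank_eq_zero [W.IsElliptic] [W.IsGloballyMinimal]
    (h0 : thmE_analyticRank_eq_zero_of_selmerCorank_eq_zero)
    (hp : 2 < p) (hgood : Good W p) (hred : Red W p) (hna : ¬ Anom W p)
    (hrank : W.mordellWeilRank = 0) (hsha : Finite (AddCommGroup.primaryComponent W.sha p)) :
    W.analyticRank = 0 :=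
  h0 W p hp hgood hred hna
    ((selmerCorank_eq_mordellWeilRank_of_finite_shaPrimary W p hsha).trans hrank)

/-- **The `p`-converse for `r ∈ {0,1}` in rank form**: under Theorem E's hypotheses on `(E, p)`,
`rank_ℤ E(ℚ) ≤ 1` and `#Ш(E/ℚ)[p^∞] < ∞` ⇒ `ord_{s=1} L(E,s) = rank_ℤ E(ℚ)` (both clauses, through
`corank Sel_{p^∞} = rank + corank Ш[p^∞]`). [cite: CastellaGrossiLeeSkinner2022, Theorem E (final version) and the remark following it] -/
theorem analyticRank_eq_mordellWeilRank_of_thmE_of_rank_le_one [W.IsElliptic] [W.IsGloballyMinimal]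
    (h1 : thmE_analyticRank_eq_one_of_selmerCorank_eq_one)
    (h0 : thmE_analyticRank_eq_zero_of_selmerCorank_eq_zero)
    (hp : 2 < p) (hgood : Good W p) (hred : Red W p) (hna : ¬ Anom W p)
    (hrank : W.mordellWeilRank ≤ 1) (hsha : Finite (AddCommGroup.primaryComponent W.sha p)) :
    W.analyticRank = W.mordellWeilRank :=
  analyticRank_eq_of_thmE_of_selmerCorank_eq h1 h0 hp hgood hred hna
    (by rcases Nat.le_one_iff_eq_zero_or_eq_one.mp hrank with h | h <;> simp [h])
    (selmerCorank_eq_mordellWeilRank_of_finite_shaPrimary W p hsha)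

/-- **Rank zero is analytic rank zero at a non-anomalous Eisenstein prime**: under Theorem E's
hypotheses on `(E, p)` and `#Ш(E/ℚ)[p^∞] < ∞`, `rank_ℤ E(ℚ) = 0 ↔ ord_{s=1} L(E,s) = 0` — Theorem E
(`r = 0`) one way, Gross–Zagier–Kolyvagin (`hGZK`) the other. [cite: CastellaGrossiLeeSkinner2022, Theorem E (final version, r = 0) with (GZK)] -/
theorem mordellWeilRank_eq_zero_iff_analyticRank_eq_zero_of_thmE [W.IsElliptic]
    [W.IsGloballyMinimal] (h0 : thmE_analyticRank_eq_zero_of_selmerCorank_eq_zero)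
    (hGZK : rank_eq_analyticRank_of_analyticRank_le_one)
    (hp : 2 < p) (hgood : Good W p) (hred : Red W p) (hna : ¬ Anom W p)
    (hsha : Finite (AddCommGroup.primaryComponent W.sha p)) :
    W.mordellWeilRank = 0 ↔ W.analyticRank = 0 := by
  refine ⟨fun hrank ↦ analyticRank_eq_zero_of_thmE_of_mordellWeilRank_eq_zero h0 hp hgood hred hna
    hrank hsha, fun hr ↦ ?_⟩
  exact (hGZK W (by omega)).1.trans hr

/-- **Case `r = 0` in `a_p`-form** (lane-decidable hypothesis `a_p ≢ 1 (mod p)`):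
`corank_{ℤ_p} Sel_{p^∞}(E/ℚ) = 0 ⇒ ord_{s=1} L(E,s) = 0`.
[cite: CastellaGrossiLeeSkinner2022, Theorem E = Thm. 5.2.1, case r = 0 (final version)] -/
theorem analyticRank_eq_zero_of_thmE_of_not_dvd [W.IsElliptic] [W.IsGloballyMinimal]
    (h0 : thmE_analyticRank_eq_zero_of_selmerCorank_eq_zero)
    (hp : 2 < p) (hgood : Good W p) (hred : Red W p) (hap : ¬ (p : ℤ) ∣ W.frobeniusTrace p - 1)
    (hcork : W.selmerCorank p = 0) : W.analyticRank = 0 :=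
  h0 W p hp hgood hred ((CastellaGrossiSkinner2025.not_anom_iff_of_red_of_good hred hgood).2 hap)
    hcork

end Literature.NumberTheory.EllipticCurves.CastellaGrossiLeeSkinner2022
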